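import Summits.BirchSwinnertonDyer.Rank1Residual.X5.TwoAdicTargetsMultTam
import Literature.NumberTheory.EllipticCurves.Greenberg1999.TwoTorsionMuInvariant
import HarnessLib

/-!
# Route `ByReductionTypeAtTwo`, crux `MultUpperHalfAtTwo` (item stmt-BirchSwinnertonDyer-19922): the «NEITHER» binder —
# Greenberg's `μ = 0` conjecture at `2` for a rational `2`-torsion point that is NEITHER ramified NOR odd, as ONE closed
# constant (`@[conjecture]`, nothing asserted) + the door it feeds (the μ-road upper half on the neither locus)

HONEST FRAMING (cell `bsd-2adic`, run/shared/lean/pub/bsd-2adic/, seat `bsd-2adic-mult` GEN 14, HUMAN RULINGS D-0036 /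
D-0054 / D-0074): 142 of the 194 classes of the WALL `stub_offSixRoads` of the line `four_roads` are «neither» classes: the
`X₀(N)`-optimal curve `E₀` has `E₀(ℚ)[2] = ⟨P⟩` with `⟨P⟩ ⊄ C₂` (not ramified at `2`: `v₂(x(P)) ≥ 0` on the minimal model) and
`⟨P⟩ ⊄ C_∞` (not odd: `x(P)` is not the least real root of the `2`-division cubic) — so Greenberg's Props. 5.13/5.14
(`Literature/…/Greenberg1999/TwoTorsionMuInvariant.lean`, PRINT) say nothing, while Greenberg CONJECTURES `μ_E = m_E = 0` for them
(LNM 1716 p. 121/171: «Conjecturally, μ_E = m_E»). This file DECLARES that conjecture, restricted to exactly this locus, as a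
`Prop` (`neitherMuZeroAtTwo`, tagged `@[conjecture]`; NOT a Literature fact — it is not a printed theorem at any prime: odd-`p`
analogue = the «harder reducible case», Trifković, Canad. J. Math. 57 (2005) 812–843; A. Ray, arXiv:2308.06673) and proves the
DOOR `missingUpperBoundAt_two_mult_of_neitherMu` = the cell's μ-road door `O1.missingUpperBoundAt_two_mult_of_mu_eq_zero` with
`hμ` fed from the binder on the neither locus — the twin of `O1.missingUpperBoundAt_two_mult_of_prop514`.
WHY A CELL SEAT MAY DISPLAY IT: the cell memo HOME/mult/PROOF-NEITHER.md (this seat, 2026-08-27) proves that for such `E`, with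
`F = ℚ_∞(√Δ_E)` (the cyclotomic `ℤ₂`-tower of the real quadratic `2`-division field) and the «configuration» `(T_Q, 𝔮_Q)` of `E`,
`Sel_E(ℚ_∞)₂[2]` is, up to finite groups, `Hom(Gal(𝔐/F), ℤ/2)` for the maximal abelian pro-`2` extension `𝔐/F` unramified outside
`{s𝔮_Q} ∪ {real places ∉ T_Q}`, that the mixed ray class groups `𝒞_n = Cl_{s𝔮_Q^{2^{n+1}+1}·𝔫_n·∏_{w ∉ T_Q} w}(F_n) ⊗ ℤ₂` (`𝔫_n` = the odd bad primes at which the local condition is not trivial) satisfy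
`𝒞_n = 𝔛/ω_n𝔛` EXACTLY, and hence the ONE-LAYER CRITERION «`rank₂ 𝒞_n < 2^n` for some `n`» ⟹ `μ(X(E/ℚ_∞)) = 0 ∧ X torsion`
(memo Theorem A, with the exact local conditions at the odd bad primes of memo Lemma 3(iii)); kit job j281904 decides it class by class. So per class the binder below is MEMO + ONE ray-class-group
CERTIFICATE of an abelian field of degree `≤ 32`; as a ∀-statement it stays a conjecture (memo Theorem B proves only that for each
real quadratic field at most one of the two configurations can fail). Nothing is booked by this file; BSD is not proved by any of it.
References: R. Greenberg, LNM 1716 (1999) §5 Props. 5.13, 5.14, p. 121 Remark; §2; §4 pp. 112–113. M. Trifković, Canad. J. Math. 57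
(2005) 812–843. Cell memo HOME/mult/PROOF-NEITHER.md.
-/

set_option autoImplicit false
-- the Theorems namespace of this sub repeats the summit name by design (D-0017 nested layout: Summit.<S>.<Sub>)
set_option linter.dupNamespace false

noncomputable section

open scoped Classical MatrixGroups ModularForm

open CongruenceSubgroup WeierstrassCurve NumberField IsDedekindDomain
  Literature.NumberTheory.EllipticCurves
  Literature.NumberTheory.EllipticCurves.ModularForms
  Literature.NumberTheory.EllipticCurves.Greenberg1999
  Literature.NumberTheory.EllipticCurves.Rank1Residual
  Literature.NumberTheory.EllipticCurves.Rank1Residual.Typed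
  Summit.BirchSwinnertonDyer.Rank1Residual.X5

namespace Summit.BirchSwinnertonDyer.BirchSwinnertonDyer.Theorems.MultNeither

/-- [crux 19922, CONJECTURE / MEMO binder `hNei`] **Greenberg's `μ`-conjecture at `2` on the NEITHER locus.** For every globally
minimal elliptic `W/ℚ` with good ordinary or multiplicative reduction at `2` and a rational affine point `(x, y)` of order `2`
(`2y + a₁x + a₃ = 0`) that is NEITHER ramified at `2` (`¬ v₂(x) < 0`) NOR odd (`x` is not the least real root of
`4r³ + b₂r² + 2b₄r + b₆`): for the cyclotomic `ℤ₂`-extension `κ`, every topological generator `γ` and every dual datum `D` of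
`Sel_{2^∞}(E/ℚ_∞)` (archimedean conditions included), `X(E/ℚ_∞)` is `Λ`-torsion with `μ = 0`. Greenberg, LNM 1716 p. 121:
«Conjecturally, μ_E = m_E» — here `m_E = 0` (the only `G_ℚ`-stable subgroup of order `2` is `⟨P⟩`, which is neither ramified nor
odd, so no cyclic rational subgroup of `E[2^∞]` is ramified-and-odd). NOT in print as a theorem; the cell memo PROOF-NEITHER.md
gives an equivalent one-layer ray-class-group criterion and decides it per curve. Nothing asserted.
[cite: GreenbergLNM1716, Props. 5.13–5.14 and the Remark p. 121 (shape; the conjecture μ_E = m_E)] -/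
@[conjecture] def neitherMuZeroAtTwo : Prop :=
  ∀ (W : WeierstrassCurve ℚ) [W.IsElliptic] [W.IsGloballyMinimal],
    ((W.HasGoodReductionAtPrime 2 ∧ ¬ (2 : ℤ) ∣ W.frobeniusTrace 2) ∨
      W.HasMultiplicativeReductionAtPrime 2) →
    ∀ (x y : ℚ), W.toAffine.Equation x y → 2 * y + W.a₁ * x + W.a₃ = 0 →
    ¬ TwoTorsionRamifiedAtTwo x → ¬ TwoTorsionOdd W x →
    ∀ (κ : ZpExtension ℚ 2) (γ : Field.absoluteGaloisGroup ℚ),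
        κ.IsCyclotomic → κ.IsTopGenerator γ →
      ∀ (D : W.SelmerDualData κ γ), D.IsTorsion ∧ D.mu = 0

/-- `neitherMuZeroAtTwo` unfolds to the displayed binder. [folklore] -/
theorem neitherMuZeroAtTwo_iff : neitherMuZeroAtTwo ↔
    ∀ (W : WeierstrassCurve ℚ) [W.IsElliptic] [W.IsGloballyMinimal],
      ((W.HasGoodReductionAtPrime 2 ∧ ¬ (2 : ℤ) ∣ W.frobeniusTrace 2) ∨
        W.HasMultiplicativeReductionAtPrime 2) →
      ∀ (x y : ℚ), W.toAffine.Equation x y → 2 * y + W.a₁ * x + W.a₃ = 0 →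
      ¬ TwoTorsionRamifiedAtTwo x → ¬ TwoTorsionOdd W x →
      ∀ (κ : ZpExtension ℚ 2) (γ : Field.absoluteGaloisGroup ℚ),
          κ.IsCyclotomic → κ.IsTopGenerator γ →
        ∀ (D : W.SelmerDualData κ γ), D.IsTorsion ∧ D.mu = 0 :=
  Iff.rfl

/-- **The three loci of a rational `2`-torsion point are exhaustive** (bookkeeping): a rational point of order `2` is either
ramified-XOR-odd (Prop. 5.14's hypothesis), or ramified-AND-odd (Prop. 5.13's), or NEITHER (this file's). [folklore] -/
theorem xor_or_both_or_neither (W : WeierstrassCurve ℚ) (x : ℚ) :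
    ((TwoTorsionRamifiedAtTwo x ∧ ¬ TwoTorsionOdd W x) ∨ (TwoTorsionOdd W x ∧ ¬ TwoTorsionRamifiedAtTwo x)) ∨
      (TwoTorsionRamifiedAtTwo x ∧ TwoTorsionOdd W x) ∨
      (¬ TwoTorsionRamifiedAtTwo x ∧ ¬ TwoTorsionOdd W x) := by
  by_cases h₁ : TwoTorsionRamifiedAtTwo x <;> by_cases h₂ : TwoTorsionOdd W x <;> simp [h₁, h₂]

/-- **DOOR (PROVED): the BSD-sharp upper half `MissingUpperBoundAt W 2` at a MULTIPLICATIVE `2`, analytic rank `0`, on the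
NEITHER locus** — the cell's μ-road door `O1.missingUpperBoundAt_two_mult_of_mu_eq_zero` (`X5/TwoAdicTargetsMultTam.lean`) with
its binder `hμ` supplied by `neitherMuZeroAtTwo` at the displayed decidable datum (a rational `2`-torsion point `(x, y)` with
`¬ v₂(x) < 0` and `x` not minimal among the real `2`-torsion abscissae); the twin of `O1.missingUpperBoundAt_two_mult_of_prop514`.
Remaining displayed inputs, unchanged from that door: Greenberg–Stevens at a split `2` (`hGS`), Greenberg's Thm-4.1 analogues
(`h41n`, `h41s`; PRINT), modularity, GZK, K11a/K11b-Rat (`hKn`, `hKs`), the period certificate `hper₀`, `r_an = 0`.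
[cite: GreenbergLNM1716, §4 pp. 112–113 and Prop. 5.14 p. 121 (shape)] [cite: Miller2011LMS, Def. 1.1] -/
theorem missingUpperBoundAt_two_mult_of_neitherMu
    (W : WeierstrassCurve ℚ) [W.IsElliptic] [W.IsGloballyMinimal]
    (hNei : neitherMuZeroAtTwo)
    (hGS : greenberg_stevens (W := W) (p := 2))
    (h41n : thm41Analogue_charValue_rankZero_numberField_anyPrime)
    (h41s : thm41Analogue_charValue_rankZero_split_baseChange_anyPrime)
    (hmod : nonempty_modularParametrizationData)
    (hGZK : rank_eq_analyticRank_of_analyticRank_le_one)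
    (hKn : ∀ [NeZero (W.conductorNorm ℤ)] (f : CuspForm (Gamma0 (W.conductorNorm ℤ)) 2)
      (L : PowerSeries ℚ_[2]), O1.KatoDivisibilityAtTwoNonsplitMultRat W f L)
    (hKs : ∀ [NeZero (W.conductorNorm ℤ)] (f : CuspForm (Gamma0 (W.conductorNorm ℤ)) 2)
      (L : PowerSeries ℚ_[2]), O1.KatoDivisibilityAtTwoSplitMultRat W f L)
    (hper₀ : ∀ [NeZero (W.conductorNorm ℤ)] (f : CuspForm (Gamma0 (W.conductorNorm ℤ)) 2),
      IsNewformOf W f → ∀ ϖ : ℚ, (ϖ : ℝ) * W.realPeriodRat = plusPeriod f → 0 ≤ padicValRat 2 ϖ)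
    (hr : W.analyticRank = 0) (hmult : Mult W 2)
    {x y : ℚ} (hP : W.toAffine.Equation x y) (h2 : 2 * y + W.a₁ * x + W.a₃ = 0)
    (hnr : ¬ TwoTorsionRamifiedAtTwo x) (hno : ¬ TwoTorsionOdd W x) : MissingUpperBoundAt W 2 :=
  O1.missingUpperBoundAt_two_mult_of_mu_eq_zero W hGS h41n h41s hmod hGZK hKn hKs
    (fun κ γ hκ hγ _ D => (hNei W (Or.inr hmult) x y hP h2 hnr hno κ γ hκ hγ D).2) hper₀ hr hmult

end Summit.BirchSwinnertonDyer.BirchSwinnertonDyer.Theorems.MultNeither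

end
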